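import Summits.QuantumFields.YangMills.Theorems.AllWindowsColdBoxBoxHighLineBoxImageFormula
import Summits.QuantumFields.YangMills.Theorems.AllWindowsColdBoxBoxHighLineBoxImageDistance
import Summits.QuantumFields.YangMills.Theorems.AllWindowsColdBoxTorusGreenGradientDecay

/-!
# Gradient decay of the Dirichlet Green function of the interior cold box, UP TO THE WALL

Route `AllWindowsColdBox`, LINE-19 S3 / LINE-20 U1 (crux ⟨stmt-QuantumFields-24336⟩, parent ⟨24004⟩; STUB-PLAN-U1 rev 2 §6: the input of the
gradient block (A) of `LandauKernelDecay`, and the model for J′1).  From the 16-image formula ✓`dirichletGreen_interiorSites_eq_imageSum`, the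
wall vanishing ✓`imageSum_eq_zero_of_wall`, the uniform torus gradient bound ✓`torusGreen_grad_mul_dist_pow_three_le` and «images are never
closer» ✓`sum_sq_sub_le_sum_valMinAbs_sq_image`:

* **`dirichletGreen_interiorSites_grad_mul_dist_pow_three_le`** — there is an absolute `C` with, for all `H ≥ 1`, all interior `x ≠ y` and every
  direction `i`, `|G_I(x + eᵢ, y) − G_I(x, y)| · |x − y|³ ≤ C` (`G_I = dirichletGreen (interiorSites H)`; `x + eᵢ` may lie on the wall, where
  `G_I = 0`).  No Poisson kernel, no interior/boundary case distinction: the estimate holds uniformly up to the frozen wall.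

Everything proved; no definitions; standard axioms.  HONEST LABEL: helper toward the kernel stubs of two critic-stamped DRAFT lines; no stub, crux,
rung or summit is proved; the Yang–Mills mass gap is NOT proved by this file.
-/

set_option autoImplicit false

noncomputable section

namespace Summit.QuantumFields.YangMills.Theorems.AllWindowsColdBoxBoxHighLine.BoxImage

open Finset
open Literature.Probability.LatticeModels
open Summit.QuantumFields.YangMills.Theorems.AllWindowsColdBox.TorusGreenGradient (torusGreen_grad_mul_dist_pow_three_le)

variable {H : ℕ} [NeZero H]

/-- The image formula also holds one step off the interior in a coordinate direction: for `x, y ∈ I` and any `i`,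
`G_I(x + eᵢ, y) = ½Σ_S (−1)^{|S|} G̃((x̄ − ε_S ȳ) + eᵢ)` (if `x + eᵢ` is on the wall both sides vanish). -/
theorem dirichletGreen_add_single_eq_imageSum {x y : Site 4} (hx : x ∈ interiorSites H) (hy : y ∈ interiorSites H) (i : Fin 4) :
    dirichletGreen (interiorSites H) (x + Pi.single i 1) y =
      (1 / 2 : ℝ) * ∑ S : Finset (Fin 4), (-1 : ℝ) ^ S.card *
        torusGreen (((fun k => ((x k : ℤ) : ZMod (4 * H))) -
          (fun k => if k ∈ S then -((y k : ℤ) : ZMod (4 * H)) else ((y k : ℤ) : ZMod (4 * H)))) + Pi.single i 1) := by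
  have hshift : ∀ S : Finset (Fin 4), ((fun k => ((x k : ℤ) : ZMod (4 * H))) -
      (fun k => if k ∈ S then -((y k : ℤ) : ZMod (4 * H)) else ((y k : ℤ) : ZMod (4 * H)))) + Pi.single i 1 =
      (fun k => (((x + Pi.single i 1 : Site 4) k : ℤ) : ZMod (4 * H))) -
        (fun k => if k ∈ S then -((y k : ℤ) : ZMod (4 * H)) else ((y k : ℤ) : ZMod (4 * H))) := by
    intro S; rw [cast_add_single, add_sub_right_comm]
  simp only [hshift]
  by_cases hxi : x + Pi.single i 1 ∈ interiorSites H
  · exact dirichletGreen_interiorSites_eq_imageSum hxi hy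
  · -- `x + eᵢ` is on the wall `x_i + 1 = 2H`
    rw [dirichletGreen_of_not_mem_left _ hxi]
    have hbx := (interiorSites_iff H x).1 hx
    have hwall : (x + Pi.single i 1 : Site 4) i = 2 * (H : ℤ) := by
      by_contra hne
      apply hxi
      rw [interiorSites_iff]
      intro k
      by_cases hk : k = i
      · subst hk; have := hbx k; simp at hne ⊢; omega
      · have := hbx k; simp [Pi.single_eq_of_ne hk]; omega
    symm
    refine imageSum_eq_zero_of_wall y (x + Pi.single i 1) i ?_
    rw [hwall, ← sub_eq_zero, sub_neg_eq_add, ← Int.cast_add, ZMod.intCast_zmod_eq_zero_iff_dvd]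
    exact ⟨1, by push_cast; ring⟩

/-- **Gradient decay of `G_I` up to the wall**: `|G_I(x + eᵢ, y) − G_I(x, y)| · |x − y|³ ≤ C` for interior `x ≠ y`, uniformly in `H`. -/
theorem dirichletGreen_interiorSites_grad_mul_dist_pow_three_le : ∃ C : ℝ, ∀ (H : ℕ) [NeZero H] (x y : Site 4) (i : Fin 4),
    x ∈ interiorSites H → y ∈ interiorSites H → x ≠ y →
      |dirichletGreen (interiorSites H) (x + Pi.single i 1) y - dirichletGreen (interiorSites H) x y| *
        Real.sqrt (∑ k : Fin 4, ((x k - y k : ℤ) : ℝ) ^ 2) ^ 3 ≤ C := by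
  obtain ⟨C₁, hC₁⟩ := torusGreen_grad_mul_dist_pow_three_le
  refine ⟨8 * max C₁ 0, ?_⟩
  intro H _ x y i hx hy hxy
  set D : ℝ := Real.sqrt (∑ k : Fin 4, ((x k - y k : ℤ) : ℝ) ^ 2) with hD
  have hD0 : 0 ≤ D := Real.sqrt_nonneg _
  set Y : Finset (Fin 4) → TorusSite 4 (4 * H) :=
    fun S k => if k ∈ S then -((y k : ℤ) : ZMod (4 * H)) else ((y k : ℤ) : ZMod (4 * H)) with hY
  set X : TorusSite 4 (4 * H) := fun k => ((x k : ℤ) : ZMod (4 * H)) with hX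
  rw [dirichletGreen_add_single_eq_imageSum hx hy i, dirichletGreen_interiorSites_eq_imageSum hx hy, ← mul_sub,
    ← Finset.sum_sub_distrib]
  -- termwise bound: every image is non-zero and at distance ≥ D
  have hterm : ∀ S : Finset (Fin 4), |torusGreen (X - Y S + Pi.single i 1) - torusGreen (X - Y S)| * D ^ 3 ≤ max C₁ 0 := by
    intro S
    have hz : X - Y S ≠ 0 := by
      intro h
      have h' : X = Y S := sub_eq_zero.1 h
      exact hxy ((cast_eq_image_iff hx hy S).1 h').2
    have h1 := hC₁ (4 * H) i (X - Y S) hz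
    have hdist : D ≤ Real.sqrt (∑ k : Fin 4, ((((X - Y S) k).valMinAbs : ℤ) : ℝ) ^ 2) :=
      Real.sqrt_le_sqrt (sum_sq_sub_le_sum_valMinAbs_sq_image hx hy S)
    calc |torusGreen (X - Y S + Pi.single i 1) - torusGreen (X - Y S)| * D ^ 3
        ≤ |torusGreen (X - Y S + Pi.single i 1) - torusGreen (X - Y S)| *
            Real.sqrt (∑ k : Fin 4, ((((X - Y S) k).valMinAbs : ℤ) : ℝ) ^ 2) ^ 3 := by
          gcongr
      _ ≤ C₁ := h1
      _ ≤ max C₁ 0 := le_max_left _ _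
  -- sum the 16 terms
  have hsum : |∑ S : Finset (Fin 4), ((-1 : ℝ) ^ S.card * torusGreen (X - Y S + Pi.single i 1) -
      (-1 : ℝ) ^ S.card * torusGreen (X - Y S))| * D ^ 3 ≤ 16 * max C₁ 0 := by
    calc |∑ S : Finset (Fin 4), ((-1 : ℝ) ^ S.card * torusGreen (X - Y S + Pi.single i 1) -
          (-1 : ℝ) ^ S.card * torusGreen (X - Y S))| * D ^ 3
        ≤ (∑ S : Finset (Fin 4), |(-1 : ℝ) ^ S.card * torusGreen (X - Y S + Pi.single i 1) -
            (-1 : ℝ) ^ S.card * torusGreen (X - Y S)|) * D ^ 3 := by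
          gcongr; exact Finset.abs_sum_le_sum_abs _ _
      _ = ∑ S : Finset (Fin 4), |torusGreen (X - Y S + Pi.single i 1) - torusGreen (X - Y S)| * D ^ 3 := by
          rw [Finset.sum_mul]
          refine Finset.sum_congr rfl fun S _ => ?_
          rw [← mul_sub, abs_mul, abs_pow, abs_neg, abs_one, one_pow, one_mul]
      _ ≤ ∑ _S : Finset (Fin 4), max C₁ 0 := Finset.sum_le_sum fun S _ => hterm S
      _ = 16 * max C₁ 0 := by
          rw [Finset.sum_const, Finset.card_univ, Fintype.card_finset, Fintype.card_fin, nsmul_eq_mul]; norm_num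
  rw [abs_mul, abs_of_pos (by norm_num : (0 : ℝ) < 1 / 2)]
  calc 1 / 2 * |∑ S : Finset (Fin 4), ((-1 : ℝ) ^ S.card * torusGreen (X - Y S + Pi.single i 1) -
        (-1 : ℝ) ^ S.card * torusGreen (X - Y S))| * D ^ 3
      = 1 / 2 * (|∑ S : Finset (Fin 4), ((-1 : ℝ) ^ S.card * torusGreen (X - Y S + Pi.single i 1) -
        (-1 : ℝ) ^ S.card * torusGreen (X - Y S))| * D ^ 3) := by ring
    _ ≤ 1 / 2 * (16 * max C₁ 0) := by gcongr
    _ = 8 * max C₁ 0 := by ring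

end Summit.QuantumFields.YangMills.Theorems.AllWindowsColdBoxBoxHighLine.BoxImage

end
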